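import Literature.MathematicalPhysics.QuantumFieldTheory.Balaban1983to89.T3UnitLawDensityEML
import HarnessLib

/-!
# `Balaban1983to89.T3UnitScaleTilt` — rung R3 (continuum `SU(2)` Yang–Mills on every three-torus): KING'S CAUCHY DEVICE AT THE
# UNIT LATTICE as a tree theorem with GENERIC good events and a FREE top fraction — «unit-scale small-field tilt (K1) ∧ summable
# UV-history tail (K2) on the refined family ⇒ `ContinuumYM3Torus F ℰ γ`», for every measurable small-loop average `ℰ` on `SU(N)`

Cell `ym3-torus` (HUMAN RULING D-0037, YM ladder rung R3), seat `ym3-torus-p2` gen 3 (E3 / IR-side node holder).  WHAT THIS IS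
NOT: not d = 4, not infinite volume, not a mass gap, not Clay, and NOT the expectations step (E3) itself: K1 (`IsTilt` of the two
runs' restricted unit-lattice push-forwards with summable radii) and K2 (summable Gibbs masses of the bad histories) are
HYPOTHESES here — they are the d = 3 expectations step, unpublished for any non-abelian gauge theory ([King1986] Thm 3.4 and
(3.9)–(3.13) is the printed abelian template; [Balaban1985UV3] prints single-run stability only).  What this file PROVES is the
deciding theorem of the cell's route `UnitScaleTilt` (HOME/route-R3, plan g5) in the tree, generalised in the two places where
the route text is rigid: (i) the good events `Gd_K` are ARBITRARY measurable sets of fine fields (the route: Bałaban's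
UV-small-history events), (ii) the number of FREE top averaging steps is `⌊K/m⌋` for an arbitrary `m` (the route: `m = 4`), and
the quantifier order `m` (K1: ∃) → threshold profile (K2: ∃) → coupling threshold is the one under which the two cruxes compose
(cell bus, lit g6 LIT-ROUTE-R3-AUDIT §E: King's printed template needs free fraction `1/m < γ/(β+γ)`, [King1986] (3.12) p.657).

THE ARGUMENT (all of it measure theory over tree theorems; [King1986] (3.9)–(3.13) «Cauchy in K» in kernel form).
§1 `IsTilt μ ν r` — «`ν = C·e^{h}·μ`, `h` measurable, `sup |h| ≤ r`, `C ≥ 0` free» — with its API: the four-measure lemma of the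
   tree (`T3ContinuumYM3Torus.abs_integral_sub_le_of_tiltSplit`) with the trivial branch folded in (`IsTilt.abs_integral_sub_le`:
   `|∫W dν − ∫W dμ| ≤ 8r + 4w + 2w'` for EVERY `r ≥ 0`), push-forward (`IsTilt.map_of_comp`: a tilt whose log-density factors
   through a measurable map pushes forward to a tilt of the same radius — the step «compare at scale η, then apply the common free
   averagings»), and the DENSITY ADAPTER `IsTilt.of_sandwich` (a pointwise two-sided sandwich `e^{−r}cρ₀ ≤ ρ₁ ≤ e^{r}cρ₀` of
   densities for one reference measure IS a tilt of radius `r` — the bridge from [Balaban1985UV3] (41)/(47)-shaped density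
   statements to the measure-level crux).
§2 Bałaban's UV-small-history events `histGood F ℰ θ K n` («every block-averaged field at heights `j ≤ K − n` has all plaquettes
   within `θ(K−j)` of `1`», [Balaban1985UV3] (7) p.257) and their measurability for measurable `ℰ`.
§3 THE CORE: `UnitTiltTail F ℰ hE γ r w w'` (K1 ∧ K2 at the unit lattice with arbitrary measurable events) ⇒ every bounded
   measurable unit-field observable has summable increments `8r_K + 4w_K + 2w'_K` along the unit laws
   (`abs_integral_unitLaw_succ_sub_le`) ⇒ its unit-law integrals converge (`exists_tendsto_integral_unitLaw`) ⇒
   `HasContinuumLimit` for the family itself (`hasContinuumLimit_of_unitTiltTail`) AND for every COARSER family of which it is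
   the refinement (`hasContinuumLimit_of_refine_unitTiltTail`, via the tree's `expectAt_refine`: the original strings from index
   `n` on are integrals of the bounded measurable `coarseObs` — no continuity of `ℰ` needed, unlike the node's N9 transfer at `ℰc`);
   on `SU(N)`: `continuumYM3Torus_of_refine_unitTiltTail` (RP, covariance, uniqueness are tree theorems); and the by-name link to
   the node's DAG: `expectations3T_of_unitTiltTail` (K1 ∧ K2 at the unit lattice inhabit `T3ContinuumYM3Torus.Expectations3T`).
§4 THE ROUTE SHAPES with a free top fraction: `θBal L γ b₀ p₀` (thresholds `√(γL^{-i})·p(√(γL^{-i}))`, `p = B10.pFun b₀ p₀`),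
   `UnitTiltAt F γ b₀ p₀ m` / `HistoryTailAt F γ b₀ p₀ m` (= the route's K1 / K2 bodies for one family and coupling at the printed
   smearing `expMeanLogSU` on `SU(2)`, with `K / m` for the route's `K / 4`), `continuumYM3Torus_of_unitTiltAt_historyTailAt`
   (one family: both at `F.refine n`, `γL^{-n}` ⇒ R3 for `F` at `γ`), and the three quantifier packages a route may cite by name:
   `continuumYM3Torus_of_K1_K2_fixed m` (both cruxes at one fixed `m`, e.g. the filed `m = 4`),
   `continuumYM3Torus_of_K1_K2` (K1 `∀ L, ∃ m > 0, ∀ profile …` ∧ K2 `∀ L, ∀ m > 0, ∃ profile …` — RECOMMENDED), and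
   `continuumYM3Torus_of_K1_K2'` (K1 `∀ L profile, ∃ m > 0 …` ∧ K2 `∀ L, ∃ profile, ∀ m > 0 …`).  All conclude the THRESHOLD-FREE
   statement `∀ F, ∀ γ > 0, ContinuumYM3Torus F expMeanLogSU γ` (the threshold is removed by refinement inside the proof).
   Why `m > 0`: at `m = 0` (`K / 0 = 0` free steps) K2 would assert summable masses of unit-scale large fields, which is false;
   for `m ≥ 1` only the approximations `K ≥ m` have free top steps and finitely many `K` do not affect summability.
-/

noncomputable section

open MeasureTheory Filter Topology
open Literature.MathematicalPhysics.QuantumFieldTheory.Balaban1983to89.T3ContinuumYM3Torus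
open Literature.MathematicalPhysics.QuantumFieldTheory.Balaban1983to89.T3LevelShift
open Literature.MathematicalPhysics.QuantumFieldTheory.Balaban1983to89.T3ThresholdRemoval
open Literature.MathematicalPhysics.QuantumFieldTheory.Balaban1983to89.T3UnitLawDensityEML (ℰp measurableE_ℰp)
open Literature.MathematicalPhysics.QuantumFieldTheory.Balaban1983to89.Missing
open Literature.MathematicalPhysics.QuantumFieldTheory.Balaban1983to89.T4Continuum

namespace Literature.MathematicalPhysics.QuantumFieldTheory.Balaban1983to89.T3UnitScaleTilt

/-! ## §1 Tilts modulo constants: the King comparison shape at the level of measures -/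

section Tilt

variable {X : Type*} [MeasurableSpace X]

/-- **`IsTilt μ ν r`** — the run-`(K+1)` law `ν` is a TILT MODULO A CONSTANT of the run-`K` law `μ`: `ν = (C·e^{h})·μ` with `h`
measurable, `sup |h| ≤ r`, `C ≥ 0` free (pinned by normalisation in every use).  The measure-level form of [King1986] (3.9)
(«the effective densities of the two cut-offs agree up to `e^{±O(L^{-γk})}`»); `r ≥ 0` is part of the predicate. [cite: King1986, Thm 3.4 (3.9) p.656] -/
def IsTilt (μ ν : Measure X) (r : ℝ) : Prop :=
  0 ≤ r ∧ ∃ (h : X → ℝ) (C : ℝ), Measurable h ∧ 0 ≤ C ∧ (∀ x, |h x| ≤ r) ∧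
    ν = μ.withDensity fun x => ENNReal.ofReal (C * Real.exp (h x))

namespace IsTilt

variable {μ ν : Measure X} {r : ℝ}

/-- The radius of a tilt is non-negative. [cite: King1986, Thm 3.4 (3.9) p.656] -/
theorem nonneg (h : IsTilt μ ν r) : 0 ≤ r := h.1

/-- Radii may be enlarged. [cite: King1986, Thm 3.4 (3.9) p.656] -/
theorem mono (h : IsTilt μ ν r) {s : ℝ} (hrs : r ≤ s) : IsTilt μ ν s := by
  obtain ⟨hr, g, C, hgm, hC, hg, hν⟩ := h
  exact ⟨hr.trans hrs, g, C, hgm, hC, fun x => (hg x).trans hrs, hν⟩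

/-- Every measure is a tilt of itself with radius `0` (`h = 0`, `C = 1`). [cite: King1986, Thm 3.4 (3.9) p.656] -/
theorem refl (μ : Measure X) : IsTilt μ μ 0 :=
  ⟨le_rfl, fun _ => 0, 1, measurable_const, zero_le_one, fun _ => by simp, by simp⟩

/-- The zero measure is a tilt of every measure (`C = 0`). [cite: King1986, Thm 3.4 (3.9) p.656] -/
theorem zero_right (μ : Measure X) {r : ℝ} (hr : 0 ≤ r) : IsTilt μ 0 r :=
  ⟨hr, fun _ => 0, 0, measurable_const, le_rfl, fun _ => by simpa using hr, by simp⟩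

/-- **TILTS COMPOSE, RADII ADD** (`C₁e^{h₁}·C₂e^{h₂} = C₁C₂·e^{h₁+h₂}`): the comparison is a pseudo-metric step, so a K1
proof may pass through intermediate laws (e.g. both runs compared with a common reference). [cite: King1986, Thm 3.4 (3.9) p.656] -/
theorem trans {κ : Measure X} {s : ℝ} (h₁ : IsTilt μ ν r) (h₂ : IsTilt ν κ s) : IsTilt μ κ (r + s) := by
  obtain ⟨hr, g₁, C₁, hg₁m, hC₁, hg₁, hν⟩ := h₁
  obtain ⟨hs, g₂, C₂, hg₂m, hC₂, hg₂, hκ⟩ := h₂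
  refine ⟨add_nonneg hr hs, fun x => g₁ x + g₂ x, C₁ * C₂, hg₁m.add hg₂m, mul_nonneg hC₁ hC₂, fun x => ?_, ?_⟩
  · exact (abs_add_le _ _).trans (add_le_add (hg₁ x) (hg₂ x))
  · have hm₁ : Measurable fun x => ENNReal.ofReal (C₁ * Real.exp (g₁ x)) :=
      ((Real.measurable_exp.comp hg₁m).const_mul C₁).ennreal_ofReal
    have hm₂ : Measurable fun x => ENNReal.ofReal (C₂ * Real.exp (g₂ x)) :=
      ((Real.measurable_exp.comp hg₂m).const_mul C₂).ennreal_ofReal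
    rw [hκ, hν, ← withDensity_mul _ hm₁ hm₂]
    refine withDensity_congr_ae (ae_of_all _ fun x => ?_)
    show ENNReal.ofReal (C₁ * Real.exp (g₁ x)) * ENNReal.ofReal (C₂ * Real.exp (g₂ x)) =
      ENNReal.ofReal (C₁ * C₂ * Real.exp (g₁ x + g₂ x))
    rw [← ENNReal.ofReal_mul (mul_nonneg hC₁ (Real.exp_pos _).le), Real.exp_add]
    ring_nf

/-- **TILTS ARE SYMMETRIC** away from the degenerate constant `C = 0` (which forces `ν = 0`): if `ν ≠ 0` is a tilt of `μ` of
radius `r` then `μ` is a tilt of `ν` of radius `r` (`μ = C⁻¹e^{−h}·ν`). [cite: King1986, Thm 3.4 (3.9) p.656] -/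
theorem symm (h : IsTilt μ ν r) (hν : ν ≠ 0) : IsTilt ν μ r := by
  obtain ⟨hr, g, C, hgm, hC, hg, hν'⟩ := h
  have hC0 : C ≠ 0 := by
    rintro rfl
    apply hν
    rw [hν']
    simp
  have hCpos : 0 < C := lt_of_le_of_ne hC (Ne.symm hC0)
  refine ⟨hr, fun x => -g x, C⁻¹, hgm.neg, (inv_pos.mpr hCpos).le, fun x => by rw [abs_neg]; exact hg x, ?_⟩
  have hm₁ : Measurable fun x => ENNReal.ofReal (C * Real.exp (g x)) :=
    ((Real.measurable_exp.comp hgm).const_mul C).ennreal_ofReal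
  have hm₂ : Measurable fun x => ENNReal.ofReal (C⁻¹ * Real.exp (-g x)) :=
    ((Real.measurable_exp.comp hgm.neg).const_mul C⁻¹).ennreal_ofReal
  rw [hν', ← withDensity_mul _ hm₁ hm₂]
  have h1 : (fun x => ENNReal.ofReal (C * Real.exp (g x))) * (fun x => ENNReal.ofReal (C⁻¹ * Real.exp (-g x))) = 1 := by
    funext x
    show ENNReal.ofReal (C * Real.exp (g x)) * ENNReal.ofReal (C⁻¹ * Real.exp (-g x)) = 1
    rw [← ENNReal.ofReal_mul (mul_nonneg hC (Real.exp_pos _).le), ← ENNReal.ofReal_one]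
    congr 1
    rw [Real.exp_neg]
    field_simp
  rw [h1, withDensity_one]

/-- **THE FOUR-MEASURE LEMMA FOR TILTS, ALL RADII** (tree `abs_integral_sub_le_of_tiltSplit` for `r, w ≤ 1/2`; otherwise both
integrals are at most `1` in modulus): two probability laws split as good + bad, `μ_g + μ_b` and `ν_g + ν_b`, bad masses `≤ w`,
`≤ w'`, good parts tilt-related with radius `r` ⇒ every measurable `|W| ≤ 1` has `|∫ W d(ν_g+ν_b) − ∫ W d(μ_g+μ_b)| ≤ 8r + 4w + 2w'`.
[cite: King1986, Thm 3.4 (3.9) p.656 and Thm 2.1 p.654] -/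
theorem abs_integral_sub_le {μg μb νg νb : Measure X} [IsProbabilityMeasure (μg + μb)]
    [IsProbabilityMeasure (νg + νb)] {r w w' : ℝ} (ht : IsTilt μg νg r) (hw : μb.real Set.univ ≤ w)
    (hw' : νb.real Set.univ ≤ w') {W : X → ℝ} (hWm : Measurable W) (hW : ∀ x, |W x| ≤ 1) :
    |(∫ x, W x ∂(νg + νb)) - ∫ x, W x ∂(μg + μb)| ≤ 8 * r + 4 * w + 2 * w' := by
  obtain ⟨hr0, h, C, hhm, hC, hh, htilt⟩ := ht
  have hw0 : 0 ≤ w := measureReal_nonneg.trans hw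
  have hw'0 : 0 ≤ w' := measureReal_nonneg.trans hw'
  by_cases hc : r ≤ 1 / 2 ∧ w ≤ 1 / 2
  · exact (abs_integral_sub_le_of_tiltSplit hw hw' hc.2 hr0 hc.1 hhm hC hh htilt hWm hW).trans (by linarith)
  · have hb : ∀ (κ : Measure X), IsProbabilityMeasure κ → |∫ x, W x ∂κ| ≤ 1 := fun κ _ => by
      have h1 := norm_integral_le_of_norm_le_const (μ := κ) (C := 1) (f := W)
        (ae_of_all _ fun x => by rw [Real.norm_eq_abs]; exact hW x)
      rwa [Real.norm_eq_abs, probReal_univ, mul_one] at h1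
    obtain ⟨a1, a2⟩ := abs_le.mp (hb _ ‹IsProbabilityMeasure (νg + νb)›)
    obtain ⟨b1, b2⟩ := abs_le.mp (hb _ ‹IsProbabilityMeasure (μg + μb)›)
    rcases not_and_or.mp hc with hc | hc <;> have hc' := not_le.mp hc <;> exact abs_le.mpr ⟨by linarith, by linarith⟩

/-- Push-forward of a density that factors through the map: `(μ.withDensity (d ∘ f)).map f = (μ.map f).withDensity d`
(change of variables). [cite: King1986, Thm 3.4 (3.9) p.656] -/
theorem map_withDensity_comp {Y : Type*} [MeasurableSpace Y] (μ : Measure X) {f : X → Y} (hf : Measurable f)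
    {d : Y → ENNReal} (hd : Measurable d) :
    (μ.withDensity fun x => d (f x)).map f = (μ.map f).withDensity d := by
  ext s hs
  rw [Measure.map_apply hf hs, withDensity_apply _ (hf hs), withDensity_apply _ hs, setLIntegral_map hs hd hf]

/-- **TILTS PUSH FORWARD**: if `ν = (C·e^{g∘f})·μ` with the log-density factoring through a measurable `f : X → Y`, then
`ν.map f` is a tilt of `μ.map f` with the same radius (`sup |g| ≤ r`).  This is the step «compare the two runs at the last
constrained height, then apply the COMMON free block averagings to both»: the free steps cost nothing. [cite: King1986, Thm 3.4 (3.9) p.656] -/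
theorem map_of_comp {Y : Type*} [MeasurableSpace Y] {μ ν : Measure X} {f : X → Y} (hf : Measurable f) {r : ℝ}
    (hr : 0 ≤ r) {g : Y → ℝ} {C : ℝ} (hgm : Measurable g) (hC : 0 ≤ C) (hg : ∀ y, |g y| ≤ r)
    (hν : ν = μ.withDensity fun x => ENNReal.ofReal (C * Real.exp (g (f x)))) :
    IsTilt (μ.map f) (ν.map f) r := by
  refine ⟨hr, g, C, hgm, hC, hg, ?_⟩
  rw [hν]
  exact map_withDensity_comp μ hf (d := fun y => ENNReal.ofReal (C * Real.exp (g y)))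
    ((Real.measurable_exp.comp hgm).const_mul C).ennreal_ofReal

/-- **THE DENSITY ADAPTER**: a pointwise two-sided sandwich MODULO A CONSTANT of two non-negative measurable densities for one
reference measure `λ` — `e^{−r}·c·ρ₀ ≤ ρ₁ ≤ e^{r}·c·ρ₀` everywhere, `c > 0`, `r ≥ 0` — makes `ρ₁λ` a tilt of `ρ₀λ` of radius `r`
(`h = log(ρ₁/(cρ₀))` on `{ρ₀ > 0}`, `0` elsewhere; where `ρ₀ = 0` the sandwich forces `ρ₁ = 0`).  The bridge from density
statements of the shape [Balaban1985UV3] (41)/(47) («`χ_k exp(−…−R₋) ≤ ρ_k ≤ …`», two runs compared) to the measure-level K1. [cite: Balaban1985UV3, (41) p.266 and (47) p.267] -/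
theorem of_sandwich (lam : Measure X) {ρ₀ ρ₁ : X → ℝ} (hm₀ : Measurable ρ₀) (hm₁ : Measurable ρ₁)
    (h₀ : ∀ x, 0 ≤ ρ₀ x) {r c : ℝ} (hr : 0 ≤ r) (hc : 0 < c)
    (hs : ∀ x, Real.exp (-r) * c * ρ₀ x ≤ ρ₁ x ∧ ρ₁ x ≤ Real.exp r * c * ρ₀ x) :
    IsTilt (lam.withDensity fun x => ENNReal.ofReal (ρ₀ x)) (lam.withDensity fun x => ENNReal.ofReal (ρ₁ x)) r := by
  classical
  -- the log-density
  let h : X → ℝ := fun x => if 0 < ρ₀ x then Real.log (ρ₁ x / (c * ρ₀ x)) else 0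
  have hhm : Measurable h :=
    Measurable.ite (measurableSet_lt measurable_const hm₀) ((hm₁.div (hm₀.const_mul c)).log) measurable_const
  -- where `ρ₀ > 0`: `ρ₁ > 0` and the ratio lies in `[e^{-r}, e^{r}]`
  have hpos : ∀ x, 0 < ρ₀ x → 0 < ρ₁ x := fun x hx =>
    lt_of_lt_of_le (mul_pos (mul_pos (Real.exp_pos _) hc) hx) (hs x).1
  have hratio : ∀ x, 0 < ρ₀ x → Real.exp (-r) ≤ ρ₁ x / (c * ρ₀ x) ∧ ρ₁ x / (c * ρ₀ x) ≤ Real.exp r := by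
    intro x hx
    have hcx : 0 < c * ρ₀ x := mul_pos hc hx
    constructor
    · rw [le_div_iff₀ hcx]; have := (hs x).1; linarith [this]
    · rw [div_le_iff₀ hcx]; have := (hs x).2; linarith [this]
  have hh : ∀ x, |h x| ≤ r := by
    intro x
    by_cases hx : 0 < ρ₀ x
    · simp only [h, if_pos hx]
      obtain ⟨h1, h2⟩ := hratio x hx
      have hq : 0 < ρ₁ x / (c * ρ₀ x) := lt_of_lt_of_le (Real.exp_pos _) h1
      rw [abs_le]
      constructor
      · have := Real.log_le_log (Real.exp_pos _) h1
        rwa [Real.log_exp] at this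
      · have := Real.log_le_log hq h2
        rwa [Real.log_exp] at this
    · simp only [h, if_neg hx, abs_zero]; exact hr
  -- where `ρ₀ = 0`: `ρ₁ = 0`
  have hzero : ∀ x, ¬ 0 < ρ₀ x → ρ₀ x = 0 ∧ ρ₁ x = 0 := by
    intro x hx
    have h0 : ρ₀ x = 0 := le_antisymm (not_lt.mp hx) (h₀ x)
    refine ⟨h0, le_antisymm ?_ ?_⟩
    · have := (hs x).2; rw [h0, mul_zero] at this; exact this
    · have := (hs x).1; rw [h0, mul_zero] at this; exact this
  refine ⟨hr, h, c, hhm, hc.le, hh, ?_⟩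
  have hdm : Measurable fun x => ENNReal.ofReal (c * Real.exp (h x)) :=
    ((Real.measurable_exp.comp hhm).const_mul c).ennreal_ofReal
  rw [← withDensity_mul _ hm₀.ennreal_ofReal hdm]
  refine withDensity_congr_ae (ae_of_all _ fun x => ?_)
  show ENNReal.ofReal (ρ₁ x) = ENNReal.ofReal (ρ₀ x) * ENNReal.ofReal (c * Real.exp (h x))
  rw [← ENNReal.ofReal_mul (h₀ x)]
  congr 1
  by_cases hx : 0 < ρ₀ x
  · simp only [h, if_pos hx]
    rw [Real.exp_log (lt_of_lt_of_le (Real.exp_pos _) (hratio x hx).1)]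
    field_simp
  · obtain ⟨e0, e1⟩ := hzero x hx
    rw [e0, e1, zero_mul]

end IsTilt

end Tilt

/-! ## §2 Bałaban's UV-small-history events and their measurability -/

section Events

variable {G : Type*} [GaugeGroup G] [MeasurableSpace G] [RegularGaugeGroup G]

/-- The small-field event `{V | ∀ p, dist(V(∂p), 1) < δ}` is measurable (measurable `dist1`, finitely many plaquettes).
[cite: Balaban1987RG1, (0.18) p.255] -/
theorem measurableSet_plaqSmall {P : Params} {j : ℕ} (δ : ℝ) :
    MeasurableSet {V : GaugeField P j G | PlaqSmall δ V} := by
  have hset : {V : GaugeField P j G | PlaqSmall δ V} =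
      ⋂ p, {V | GaugeGroup.dist1 (GaugeField.plaqHol V p) < δ} := by
    ext V; simp only [PlaqSmall, Set.mem_setOf_eq, Set.mem_iInter]
  rw [hset]
  exact MeasurableSet.iInter fun p =>
    measurableSet_lt (RegularGaugeGroup.measurable_dist1.comp (Missing.measurable_plaqHol p)) measurable_const

variable (F : T3Family) (ℰ : LoopAverage G)

/-- **BAŁABAN'S UV-SMALL-HISTORY EVENT with `n` FREE TOP STEPS** of the `K`-th approximation: every block-averaged field
`Ū^{j} = avg^{j}(U)` at the heights `j ≤ K − n` (lattice spacings `L^{j}ε_K ≤ L^{-n}`) has all its plaquette variables within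
`θ(K − j)` of `1` — the decomposition of unity (7) of [Balaban1985UV3] p.257 restricted to the small-field term at every
constrained height, the last `n` averagings (to the unit lattice) left FREE. [cite: Balaban1985UV3, (7) p.257] -/
def histGood (θ : ℕ → ℝ) (K n : ℕ) : Set (GaugeField (F.P K) 0 G) :=
  {U | ∀ j, j + n ≤ K → PlaqSmall (θ (K - j))
    (Averaging.iter (fun i => BlockAveraging.blockAvg (P := F.P K) (j := i) ℰ) j U)}

/-- The UV-small-history events are measurable for a measurable small-loop average (`measurable_iter` of the tree).
[cite: Balaban1985UV3, (7) p.257] -/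
theorem measurableSet_histGood (hE : ℰ.MeasurableE) (θ : ℕ → ℝ) (K n : ℕ) :
    MeasurableSet (histGood F ℰ θ K n) := by
  unfold histGood
  rw [Set.setOf_forall]
  refine MeasurableSet.iInter fun j => ?_
  by_cases hj : j + n ≤ K
  · simp only [hj, forall_true_left]
    exact measurable_iter _ (F.avgMeasurable_of_measurableE ℰ hE K) j (measurableSet_plaqSmall _)
  · simp only [hj, IsEmpty.forall_iff, Set.setOf_true, MeasurableSet.univ]

omit [MeasurableSpace G] [RegularGaugeGroup G] in
/-- For `K < n` no height is constrained: the event is everything (with `n = 0` every height, the unit lattice included, is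
constrained). [cite: Balaban1985UV3, (7) p.257] -/
theorem histGood_of_lt {θ : ℕ → ℝ} {K n : ℕ} (h : K < n) : histGood F ℰ θ K n = Set.univ := by
  ext U
  simp only [histGood, Set.mem_setOf_eq, Set.mem_univ, iff_true]
  intro j hj
  omega

end Events

/-! ## §3 The core: K1 ∧ K2 at the unit lattice ⇒ summable increments ⇒ the continuum limit, also under refinement -/

section Core

variable (F : T3Family) {G : Type*} [GaugeGroup G] [MeasurableSpace G] [HaarData G] [RegularGaugeGroup G]
  (ℰ : LoopAverage G) (γ : ℝ)

omit [MeasurableSpace G] [HaarData G] [RegularGaugeGroup G] in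
/-- **THE UNIT TRANSPORT `A_K = unitShift ∘ avg^K`** of the `K`-th approximation (the map of the tree's `unitFactorisation`,
written on the family's own lattice type `F.P K`; [Balaban1987RG1] (0.4) iterated to the unit lattice). [cite: Balaban1987RG1, (0.4)/(0.11) p.253] -/
def unitA (K : ℕ) : GaugeField (F.P K) 0 G → GaugeField (F.P 0) 0 G :=
  fun U => unitShift F K (Averaging.iter (fun j => BlockAveraging.blockAvg (P := F.P K) (j := j) ℰ) K U)

omit [HaarData G] in
/-- `unitA` IS the map of `unitFactorisation` (definitional). [cite: Balaban1987RG1, (0.4)/(0.11) p.253] -/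
theorem unitA_eq (hE : ℰ.MeasurableE) (K : ℕ) : unitA F ℰ K = (F.unitFactorisation ℰ hE γ).A K := rfl

omit [HaarData G] in
/-- `unitA` is measurable for a measurable small-loop average. [cite: Balaban1987RG1, (0.4)/(0.11) p.253] -/
theorem measurable_unitA (hE : ℰ.MeasurableE) (K : ℕ) : Measurable (unitA F ℰ K) :=
  (measurable_unitShift F K).comp (measurable_iter _ (F.avgMeasurable_of_measurableE ℰ hE K) K)

omit [RegularGaugeGroup G] in
/-- **THE GIBBS MEASURE OF THE `K`-TH APPROXIMATION** at dimensionless coupling `γ`: the Wilson probability measure on the finest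
lattice with `β_K = (γε_K)⁻¹` ([Balaban1985UV3] (1): `g₀² = g²ε`). [cite: Balaban1985UV3, (1)-(3) p.256] -/
def gibbsK (K : ℕ) : Measure (GaugeField (F.P K) 0 G) := T4GenFunBounds.gibbsMeasure (F.P K) ((F.scheme ℰ γ).β K)

omit [RegularGaugeGroup G] in
/-- `gibbsK` unfolded (definitional). [cite: Balaban1985UV3, (1)-(3) p.256] -/
theorem gibbsK_eq (K : ℕ) : gibbsK F ℰ γ K = T4GenFunBounds.gibbsMeasure (F.P K) ((F.scheme ℰ γ).β K) := rfl

/-- The Gibbs measures are probability measures (`γ ≥ 0`). [cite: Balaban1985UV3, (1)-(3) p.256] -/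
theorem isProbabilityMeasure_gibbsK {γ : ℝ} (hγ : 0 ≤ γ) (K : ℕ) : IsProbabilityMeasure (gibbsK F ℰ γ K) :=
  T4GenFunBounds.isProbabilityMeasure_gibbsMeasure (G := G) (F.P K) (F.scheme_β_nonneg ℰ hγ K)

/-- The unit law is the push-forward of the Gibbs measure under the unit transport (definitional). [cite: Balaban1985UV3, (1)-(3) p.256] -/
theorem unitLaw_eq_map_unitA (hE : ℰ.MeasurableE) (K : ℕ) :
    F.unitLaw ℰ hE γ K = Measure.map (unitA F ℰ K) (gibbsK F ℰ γ K) := rfl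

/-- **K1 ∧ K2 AT THE UNIT LATTICE WITH ARBITRARY MEASURABLE EVENTS** (hypothesis schema, never asserted): for every `K`,
measurable events `Gd₀ K` (run `K`) and `Gd₁ K` (run `K+1`) of fine fields such that (K1) the unit-lattice push-forward
(`unitA`, `A_K = unitShift ∘ avg^K`) of run `K+1`'s Gibbs measure restricted to `Gd₁ K` is a TILT of radius `r_K` of run `K`'s
restricted to `Gd₀ K`, and (K2) the Gibbs masses of the complements are `≤ w_K`, `≤ w'_K`.  The route `UnitScaleTilt`
instantiates `Gd` with `histGood` (§4). [cite: King1986, Thm 3.4 (3.9)-(3.13) p.656] -/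
def UnitTiltTail (r w w' : ℕ → ℝ) : Prop :=
  ∃ (Gd₀ : ∀ K, Set (GaugeField (F.P K) 0 G)) (Gd₁ : ∀ K, Set (GaugeField (F.P (K + 1)) 0 G)),
    (∀ K, MeasurableSet (Gd₀ K)) ∧ (∀ K, MeasurableSet (Gd₁ K)) ∧
    (∀ K, IsTilt
      (Measure.map (unitA F ℰ K) ((gibbsK F ℰ γ K).restrict (Gd₀ K)))
      (Measure.map (unitA F ℰ (K + 1)) ((gibbsK F ℰ γ (K + 1)).restrict (Gd₁ K)))
      (r K)) ∧
    (∀ K, (gibbsK F ℰ γ K).real (Gd₀ K)ᶜ ≤ w K ∧ (gibbsK F ℰ γ (K + 1)).real (Gd₁ K)ᶜ ≤ w' K)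

variable {F ℰ γ}

/-- The unit law splits along any measurable event upstairs: `unitLaw K = (A_K)_*(Gibbs_K|S) + (A_K)_*(Gibbs_K|Sᶜ)`.
[cite: Balaban1985UV3, (7) p.257] -/
theorem unitLaw_eq_map_restrict_add (hE : ℰ.MeasurableE) (K : ℕ) {S : Set (GaugeField (F.P K) 0 G)}
    (hS : MeasurableSet S) :
    F.unitLaw ℰ hE γ K =
      Measure.map (unitA F ℰ K) ((gibbsK F ℰ γ K).restrict S) + Measure.map (unitA F ℰ K) ((gibbsK F ℰ γ K).restrict Sᶜ) := by
  rw [← Measure.map_add _ _ (measurable_unitA F ℰ hE K), Measure.restrict_add_restrict_compl hS]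
  rfl

omit [HaarData G] in
/-- The mass of a pushed-forward restricted measure is the mass of the event. [cite: Balaban1985UV3, (7) p.257] -/
theorem real_map_restrict_univ (hE : ℰ.MeasurableE) (K : ℕ) (μ : Measure (GaugeField (F.P K) 0 G))
    (S : Set (GaugeField (F.P K) 0 G)) :
    (Measure.map (unitA F ℰ K) (μ.restrict S)).real Set.univ = μ.real S := by
  rw [measureReal_def, measureReal_def, Measure.map_apply (measurable_unitA F ℰ hE K) MeasurableSet.univ,
    Set.preimage_univ, Measure.restrict_apply_univ]

/-- **SUMMABLE-SHAPED INCREMENTS**: under `UnitTiltTail F ℰ γ r w w'` (`γ ≥ 0`) every measurable unit-field observable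
`|W| ≤ 1` has `|∫ W d(unitLaw (K+1)) − ∫ W d(unitLaw K)| ≤ 8r_K + 4w_K + 2w'_K` — [King1986] (3.9) ⇒ (3.10), kernel form at
the unit lattice. [cite: King1986, Thm 3.4 (3.9)-(3.10) p.656] -/
theorem abs_integral_unitLaw_succ_sub_le (hE : ℰ.MeasurableE) (hγ : 0 ≤ γ) {r w w' : ℕ → ℝ}
    (h : UnitTiltTail F ℰ γ r w w') {W : GaugeField (F.P 0) 0 G → ℝ} (hWm : Measurable W) (hW1 : ∀ u, |W u| ≤ 1)
    (K : ℕ) :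
    |(∫ u, W u ∂F.unitLaw ℰ hE γ (K + 1)) - ∫ u, W u ∂F.unitLaw ℰ hE γ K| ≤ 8 * r K + 4 * w K + 2 * w' K := by
  obtain ⟨Gd₀, Gd₁, hGd₀, hGd₁, htilt, htail⟩ := h
  have hP : ∀ (K : ℕ) (S : Set (GaugeField (F.P K) 0 G)), MeasurableSet S → IsProbabilityMeasure
      (Measure.map (unitA F ℰ K) ((gibbsK F ℰ γ K).restrict S) +
        Measure.map (unitA F ℰ K) ((gibbsK F ℰ γ K).restrict Sᶜ)) := by
    intro K S hS
    rw [← unitLaw_eq_map_restrict_add hE K hS]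
    exact isProbabilityMeasure_unitLaw hE hγ K
  haveI := hP K (Gd₀ K) (hGd₀ K)
  haveI := hP (K + 1) (Gd₁ K) (hGd₁ K)
  rw [unitLaw_eq_map_restrict_add hE (K + 1) (hGd₁ K), unitLaw_eq_map_restrict_add hE K (hGd₀ K)]
  refine (htilt K).abs_integral_sub_le ?_ ?_ hWm hW1
  · rw [real_map_restrict_univ hE]; exact (htail K).1
  · rw [real_map_restrict_univ hE]; exact (htail K).2

/-- **KING'S CAUCHY DEVICE AT THE UNIT LATTICE**: under `UnitTiltTail` with `Σ r_K, Σ w_K, Σ w'_K < ∞` the unit-law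
integrals of every measurable unit-field observable `|W| ≤ 1` CONVERGE ([King1986] (3.13) «the sequence is Cauchy»).
[cite: King1986, Thm 3.4 (3.13) p.657] -/
theorem exists_tendsto_integral_unitLaw (hE : ℰ.MeasurableE) (hγ : 0 ≤ γ) {r w w' : ℕ → ℝ} (hr : Summable r)
    (hw : Summable w) (hw' : Summable w') (h : UnitTiltTail F ℰ γ r w w')
    {W : GaugeField (F.P 0) 0 G → ℝ} (hWm : Measurable W) (hW1 : ∀ u, |W u| ≤ 1) :
    ∃ l : ℝ, Tendsto (fun K => ∫ u, W u ∂F.unitLaw ℰ hE γ K) atTop (𝓝 l) := by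
  have hcs : CauchySeq fun K => ∫ u, W u ∂F.unitLaw ℰ hE γ K :=
    cauchySeq_of_dist_le_of_summable _
      (fun K => by
        rw [Real.dist_eq, abs_sub_comm]
        exact abs_integral_unitLaw_succ_sub_le hE hγ h hWm hW1 K)
      (((hr.mul_left 8).add (hw.mul_left 4)).add (hw'.mul_left 2))
  exact cauchySeq_tendsto_of_complete hcs

/-- Products of a list of measurable real functions are measurable (local helper). [folklore] -/
private theorem measurable_list_prod {Y : Type*} [MeasurableSpace Y] {ι : Type*} (f : ι → Y → ℝ)
    (hf : ∀ i, Measurable (f i)) : ∀ l : List ι, Measurable fun x => (l.map fun i => f i x).prod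
  | [] => by simp
  | i :: l => by
    show Measurable fun x => f i x * (l.map fun i => f i x).prod
    exact (hf i).mul (measurable_list_prod f hf l)

/-- Products of a list of functions bounded by `1` are bounded by `1` (local helper). [folklore] -/
private theorem abs_list_prod_le_one {Y : Type*} {ι : Type*} (f : ι → Y → ℝ) (hf : ∀ i x, |f i x| ≤ 1) (x : Y) :
    ∀ l : List ι, |(l.map fun i => f i x).prod| ≤ 1
  | [] => by simp
  | i :: l => by
    rw [List.map_cons, List.prod_cons, abs_mul]
    exact mul_le_one₀ (hf i x) (abs_nonneg _) (abs_list_prod_le_one f hf x l)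

/-- **K1 ∧ K2 AT THE UNIT LATTICE ⇒ THE CONTINUUM LIMIT OF ALL JOINT EXPECTATIONS** of the family itself (`γ ≥ 0`, every `G`,
every measurable `ℰ`): `UnitTiltTail F ℰ γ r w w'` with summable rates ⇒ `HasContinuumLimit (F.scheme ℰ γ)`.
[cite: King1986, Thm 2.1 p.654] -/
theorem hasContinuumLimit_of_unitTiltTail (hE : ℰ.MeasurableE) (hγ : 0 ≤ γ) {r w w' : ℕ → ℝ} (hr : Summable r)
    (hw : Summable w) (hw' : Summable w') (h : UnitTiltTail F ℰ γ r w w') : HasContinuumLimit (F.scheme ℰ γ) := by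
  intro Cs
  obtain ⟨l, hl⟩ := exists_tendsto_integral_unitLaw hE hγ hr hw hw' h
    (measurable_list_prod (fun (C : ULoop3 F) (u : GaugeField (F.P 0) 0 G) => loopAt u (C.1.atLevel 0))
      (fun C => measurable_loopAt _) Cs)
    (fun u => abs_list_prod_le_one (fun (C : ULoop3 F) (u : GaugeField (F.P 0) 0 G) => loopAt u (C.1.atLevel 0))
      (fun C u => abs_loopAt_le_one _ _) u Cs)
  refine ⟨l, ?_⟩
  have hkey : (fun K => (F.scheme ℰ γ).expectAt K Cs) =
      fun K => ∫ u, (Cs.map fun C => loopAt u (C.1.atLevel 0)).prod ∂F.unitLaw ℰ hE γ K :=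
    funext fun K => expectAt_eq_integral_unitLaw hE hγ K Cs
  rw [hkey]
  exact hl

/-- **THE SAME UNDER REFINEMENT** (the route's threshold-removal mechanism, for EVERY measurable `ℰ`): K1 ∧ K2 at the unit
lattice of the REFINED family `F.refine n` at coupling `γL^{-n}` with summable rates ⇒ `HasContinuumLimit (F.scheme ℰ γ)` for the
ORIGINAL family — its expectations from index `n` on are the integrals of the bounded measurable `coarseObs` against the refined
unit laws (tree `expectAt_refine`); no continuity of `ℰ` is used. [cite: Balaban1985UV3, (1)-(3) p.256] -/
theorem hasContinuumLimit_of_refine_unitTiltTail (hE : ℰ.MeasurableE) (n : ℕ) (hγ : 0 ≤ γ) {r w w' : ℕ → ℝ}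
    (hr : Summable r) (hw : Summable w) (hw' : Summable w')
    (h : UnitTiltTail (F.refine n) ℰ (γ * ((F.L : ℝ)⁻¹) ^ n) r w w') : HasContinuumLimit (F.scheme ℰ γ) := by
  intro Cs
  have hγ' : 0 ≤ γ * ((F.L : ℝ)⁻¹) ^ n := mul_nonneg hγ (pow_nonneg (inv_nonneg.mpr (Nat.cast_nonneg _)) n)
  obtain ⟨l, hl⟩ := exists_tendsto_integral_unitLaw hE hγ' hr hw hw' h
    (measurable_coarseObs F n ℰ hE Cs) (abs_coarseObs_le_one F n ℰ Cs)
  refine ⟨l, (tendsto_add_atTop_iff_nat n).mp ?_⟩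
  have hkey : (fun K => (F.scheme ℰ γ).expectAt (K + n) Cs) =
      fun K => ∫ u, coarseObs F n ℰ Cs u ∂(F.refine n).unitLaw ℰ hE (γ * ((F.L : ℝ)⁻¹) ^ n) K :=
    funext fun K => expectAt_refine F n ℰ hE hγ K Cs
  rw [hkey]
  exact hl

/-- **BY-NAME LINK TO THE NODE'S DAG (N7)**: K1 ∧ K2 at the unit lattice of one family inhabit the node's binder
`T3ContinuumYM3Torus.Expectations3T F ℰ γ` (height transport := the unit transport for both runs, common readout := the unit
loop products, split := `Split.ofEvents`). [cite: King1986, Thm 2.1 p.654 and Thm 3.4 (3.9) p.656] -/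
theorem expectations3T_of_unitTiltTail (hE : ℰ.MeasurableE) {r w w' : ℕ → ℝ} (hr : Summable r) (hw : Summable w)
    (hw' : Summable w') (h : UnitTiltTail F ℰ γ r w w') : Expectations3T F ℰ γ := by
  obtain ⟨Gd₀, Gd₁, hGd₀, hGd₁, htilt, htail⟩ := h
  let Φ := F.unitFactorisation ℰ hE γ
  let T : ∀ K, HeightTransport (F.scheme ℰ γ) K := fun K =>
    { X := GaugeField (F.P 0) 0 G
      A := unitA F ℰ K
      A' := unitA F ℰ (K + 1)
      measurable_A := measurable_unitA F ℰ hE K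
      measurable_A' := measurable_unitA F ℰ hE (K + 1)
      W := fun os u => (os.map fun C => Φ.W C u).prod
      measurable_W := fun os => measurable_list_prod (fun C u => Φ.W C u) (fun C => Φ.measurable_W C) os
      abs_W_le_one := fun os u => abs_list_prod_le_one (fun C u => Φ.W C u) (fun C u => Φ.abs_W_le_one C u) u os
      fac := fun os U => by
        show (os.map fun o => (F.scheme ℰ γ).obs K o U).prod = (os.map fun C => Φ.W C (Φ.A K U)).prod
        simp_rw [Φ.fac K]
      fac' := fun os U => by
        show (os.map fun o => (F.scheme ℰ γ).obs (K + 1) o U).prod = (os.map fun C => Φ.W C (Φ.A (K + 1) U)).prod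
        simp_rw [Φ.fac (K + 1)] }
  let D : ∀ K, (T K).Split := fun K => HeightTransport.Split.ofEvents (T K) (Gd₀ K) (Gd₁ K) (hGd₀ K) (hGd₁ K)
  refine ⟨T, D, r, w, w', hr, hw, hw', fun K => ⟨?_, ?_⟩, fun K => ?_⟩
  · show (Measure.map (unitA F ℰ K) ((gibbsK F ℰ γ K).restrict (Gd₀ K)ᶜ)).real Set.univ ≤ w K
    rw [real_map_restrict_univ hE]; exact (htail K).1
  · show (Measure.map (unitA F ℰ (K + 1)) ((gibbsK F ℰ γ (K + 1)).restrict (Gd₁ K)ᶜ)).real Set.univ ≤ w' K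
    rw [real_map_restrict_univ hE]; exact (htail K).2
  · exact htilt K

end Core

section CoreSU

variable {N : ℕ} [NeZero N] (F : T3Family) (ℰ : LoopAverage (Matrix.specialUnitaryGroup (Fin N) ℂ)) (hE : ℰ.MeasurableE)

include hE in
/-- **ON `SU(N)`: K1 ∧ K2 at the unit lattice of the refined family ⇒ `ContinuumYM3Torus F ℰ γ`** (all four conjuncts:
existence, uniqueness in `(L, m)`, reflection positivity, torus covariance — the last three are tree theorems,
`continuumYM3Torus_iff_hasContinuumLimit_SU`), for every measurable small-loop average `ℰ`, every `γ ≥ 0`, every refinement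
depth `n`. [cite: JaffeWittenClay2006, §6.5 p.11] -/
theorem continuumYM3Torus_of_refine_unitTiltTail (n : ℕ) {γ : ℝ} (hγ : 0 ≤ γ) {r w w' : ℕ → ℝ} (hr : Summable r)
    (hw : Summable w) (hw' : Summable w')
    (h : UnitTiltTail (F.refine n) ℰ (γ * ((F.L : ℝ)⁻¹) ^ n) r w w') : ContinuumYM3Torus F ℰ γ :=
  (continuumYM3Torus_iff_hasContinuumLimit_SU F ℰ hE hγ).mpr
    (hasContinuumLimit_of_refine_unitTiltTail hE n hγ hr hw hw' h)

include hE in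
/-- The unrefined case `n = 0` stated on `F` itself. [cite: JaffeWittenClay2006, §6.5 p.11] -/
theorem continuumYM3Torus_of_unitTiltTail {γ : ℝ} (hγ : 0 ≤ γ) {r w w' : ℕ → ℝ} (hr : Summable r)
    (hw : Summable w) (hw' : Summable w') (h : UnitTiltTail F ℰ γ r w w') : ContinuumYM3Torus F ℰ γ :=
  (continuumYM3Torus_iff_hasContinuumLimit_SU F ℰ hE hγ).mpr (hasContinuumLimit_of_unitTiltTail hE hγ hr hw hw' h)

end CoreSU

/-! ## §4 The route shapes with a free top fraction `1/m`, and the three quantifier packages -/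

section Route

/-- **BAŁABAN'S THRESHOLDS BY DISTANCE FROM THE UNIT SCALE**: `θ(i) = g_i·p(g_i)` with `g_i = √(γL^{-i})` the effective coupling at
lattice spacing `L^{-i}` (d = 3: `g_k² = g²L^kε`, [Balaban1985UV3] (3) p.256) and `p(g) = b₀(1 + log g⁻¹)^{p₀}` ((7) p.257; tree
`B10.pFun`). [cite: Balaban1985UV3, (3) p.256 and (7) p.257] -/
def θBal (L : ℕ) (γ b₀ p₀ : ℝ) (i : ℕ) : ℝ :=
  Real.sqrt (γ * ((L : ℝ)⁻¹) ^ i) * B10.pFun b₀ p₀ (Real.sqrt (γ * ((L : ℝ)⁻¹) ^ i))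

/-- **K1 BODY — UNIT TILT WITH `⌊K/m⌋` FREE TOP STEPS** (the route's `UnitTilt` for one family and one coupling, `K / m` in place of
its `K / 4`): summable radii `r_K` such that for every `K` the unit-lattice push-forward of run `K+1`'s Gibbs measure restricted to
`histGood (K+1) (K/m)` is a tilt of radius `r_K` of run `K`'s restricted to `histGood K (K/m)`, at the printed smearing on `SU(2)`.
NOT PRINTED for any non-abelian gauge theory (abelian template [King1986] Thm 3.4). [cite: King1986, Thm 3.4 (3.9) p.656] -/
def UnitTiltAt (F : T3Family) (γ b₀ p₀ : ℝ) (m : ℕ) : Prop :=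
  ∃ r : ℕ → ℝ, Summable r ∧ ∀ K : ℕ, IsTilt
    (Measure.map (unitA F ℰp K) ((gibbsK F ℰp γ K).restrict (histGood F ℰp (θBal F.L γ b₀ p₀) K (K / m))))
    (Measure.map (unitA F ℰp (K + 1))
      ((gibbsK F ℰp γ (K + 1)).restrict (histGood F ℰp (θBal F.L γ b₀ p₀) (K + 1) (K / m))))
    (r K)

/-- **K2 BODY — HISTORY TAIL WITH `⌊K/m⌋` FREE TOP STEPS** (the route's `HistoryTail` for one family and one coupling, `K / m` for
`K / 4`): a summable `w` bounding the Gibbs masses of the complements of `histGood K (K/m)` (run `K`) and `histGood (K+1) (K/m)`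
(run `K+1`).  Printed ingredient: the per-plaquette large-field factors `exp(−¼p(g_j)²)` of [Balaban1985UV3] (71); their sum into
a `K`-uniform probability bound is NOT printed. [cite: Balaban1985UV3, (71) p.273] -/
def HistoryTailAt (F : T3Family) (γ b₀ p₀ : ℝ) (m : ℕ) : Prop :=
  ∃ w : ℕ → ℝ, Summable w ∧ ∀ K : ℕ,
    (gibbsK F ℰp γ K).real (histGood F ℰp (θBal F.L γ b₀ p₀) K (K / m))ᶜ ≤ w K ∧
      (gibbsK F ℰp γ (K + 1)).real (histGood F ℰp (θBal F.L γ b₀ p₀) (K + 1) (K / m))ᶜ ≤ w K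

/-- K1 body ∧ K2 body for one family and coupling ⇒ `UnitTiltTail` (§3) with the history events. [cite: King1986, Thm 3.4 (3.9) p.656] -/
theorem unitTiltTail_of_unitTiltAt_historyTailAt {F : T3Family} {γ b₀ p₀ : ℝ} {m : ℕ} (h1 : UnitTiltAt F γ b₀ p₀ m)
    (h2 : HistoryTailAt F γ b₀ p₀ m) : ∃ r w : ℕ → ℝ, Summable r ∧ Summable w ∧ UnitTiltTail F ℰp γ r w w := by
  obtain ⟨r, hr, ht⟩ := h1
  obtain ⟨w, hw, hb⟩ := h2
  exact ⟨r, w, hr, hw, fun K => histGood F ℰp (θBal F.L γ b₀ p₀) K (K / m),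
    fun K => histGood F ℰp (θBal F.L γ b₀ p₀) (K + 1) (K / m),
    fun K => measurableSet_histGood F ℰp measurableE_ℰp _ K _,
    fun K => measurableSet_histGood F ℰp measurableE_ℰp _ (K + 1) _, ht, hb⟩

/-- **ONE FAMILY**: K1 body ∧ K2 body for the refined family `F.refine n` at `γL^{-n}` ⇒ `ContinuumYM3Torus F expMeanLogSU γ`
(`γ ≥ 0`). [cite: JaffeWittenClay2006, §6.5 p.11] -/
theorem continuumYM3Torus_of_unitTiltAt_historyTailAt (F : T3Family) {γ : ℝ} (hγ : 0 ≤ γ) (n : ℕ) {b₀ p₀ : ℝ} {m : ℕ}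
    (h1 : UnitTiltAt (F.refine n) (γ * ((F.L : ℝ)⁻¹) ^ n) b₀ p₀ m)
    (h2 : HistoryTailAt (F.refine n) (γ * ((F.L : ℝ)⁻¹) ^ n) b₀ p₀ m) : ContinuumYM3Torus F ℰp γ := by
  obtain ⟨r, w, hr, hw, h⟩ := unitTiltTail_of_unitTiltAt_historyTailAt h1 h2
  exact continuumYM3Torus_of_refine_unitTiltTail F ℰp measurableE_ℰp n hγ hr hw hw h

/-- Refinement depth below a threshold: for `γ > 0`, `γ₁ > 0`, `1 < L` there is `n` with `0 < γL^{-n} ≤ γ₁` (local helper).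
[folklore] -/
private theorem exists_refine_depth {L : ℕ} (hL : 1 < L) {γ γ₁ : ℝ} (hγ : 0 < γ) (hγ₁ : 0 < γ₁) :
    ∃ n : ℕ, 0 < γ * ((L : ℝ)⁻¹) ^ n ∧ γ * ((L : ℝ)⁻¹) ^ n ≤ γ₁ := by
  have hL' : (1 : ℝ) < L := by exact_mod_cast hL
  have hL0 : (0 : ℝ) < L := zero_lt_one.trans hL'
  obtain ⟨n, hn⟩ := ((tendsto_pow_atTop_nhds_zero_of_lt_one (inv_nonneg.mpr hL0.le)
    (inv_lt_one_of_one_lt₀ hL')).eventually (ge_mem_nhds (div_pos hγ₁ hγ))).exists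
  refine ⟨n, mul_pos hγ (pow_pos (inv_pos.mpr hL0) n), ?_⟩
  have e := mul_le_mul_of_nonneg_left hn hγ.le
  rwa [mul_div_cancel₀ _ hγ.ne'] at e

/-- **PACKAGE A (one fixed `m`, e.g. the route as filed with `m = 4`)**: K1 `∀ L profile, ∃ γ₁ > 0, ∀ F γ ≤ γ₁, UnitTiltAt … m` ∧
K2 `∀ L, ∃ profile, ∃ γ₁ > 0, ∀ F γ ≤ γ₁, HistoryTailAt … m` ⇒ **`ContinuumYM3Torus F expMeanLogSU γ` for EVERY family and EVERY
`γ > 0`** (the threshold is removed by refinement).  With `m = 4` the two hypotheses are the route's `UnitTilt` / `HistoryTail`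
unfolded. [cite: King1986, Thm 3.4 (3.9)-(3.13) p.656] -/
theorem continuumYM3Torus_of_K1_K2_fixed (m : ℕ)
    (hK1 : ∀ (L : ℕ) (b₀ p₀ : ℝ), 0 < b₀ → 2 < p₀ → ∃ γ₁ : ℝ, 0 < γ₁ ∧
      ∀ (F : T3Family) (γ : ℝ), F.L = L → 0 < γ → γ ≤ γ₁ → UnitTiltAt F γ b₀ p₀ m)
    (hK2 : ∀ (L : ℕ), ∃ (b₀ p₀ γ₁ : ℝ), 0 < b₀ ∧ 2 < p₀ ∧ 0 < γ₁ ∧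
      ∀ (F : T3Family) (γ : ℝ), F.L = L → 0 < γ → γ ≤ γ₁ → HistoryTailAt F γ b₀ p₀ m)
    (F : T3Family) {γ : ℝ} (hγ : 0 < γ) : ContinuumYM3Torus F ℰp γ := by
  obtain ⟨b₀, p₀, γ₂, hb₀, hp₀, hγ₂, hT⟩ := hK2 F.L
  obtain ⟨γ₃, hγ₃, hS⟩ := hK1 F.L b₀ p₀ hb₀ hp₀
  obtain ⟨n, hpos, hle⟩ := exists_refine_depth F.hL.2 hγ (lt_min hγ₂ hγ₃)
  exact continuumYM3Torus_of_unitTiltAt_historyTailAt F hγ.le n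
    (hS (F.refine n) _ rfl hpos (hle.trans (min_le_right _ _)))
    (hT (F.refine n) _ rfl hpos (hle.trans (min_le_left _ _)))

/-- **PACKAGE B (RECOMMENDED: K1 chooses `m` before the profile, K2 serves every `m > 0`)**: K1 `∀ L, ∃ m > 0, ∀ profile,
∃ γ₁ > 0, ∀ F γ ≤ γ₁, UnitTiltAt F γ b₀ p₀ m` ∧ K2 `∀ L, ∀ m > 0, ∃ profile, ∃ γ₁ > 0, ∀ F γ ≤ γ₁, HistoryTailAt F γ b₀ p₀ m` ⇒
**`ContinuumYM3Torus F expMeanLogSU γ` for every family and every `γ > 0`**.  Order of choices in the proof: `m` from K1 at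
`L = F.L`; the profile and its threshold from K2 at `(L, m)`; K1's threshold at that profile; refine below both.  ([King1986]
(3.12): the printed template fixes the free fraction `1/m < γ/(β+γ)` from the regularity/counting exponents, independently of
the thresholds.) [cite: King1986, (3.12) p.657] -/
theorem continuumYM3Torus_of_K1_K2
    (hK1 : ∀ (L : ℕ), ∃ m : ℕ, 0 < m ∧ ∀ (b₀ p₀ : ℝ), 0 < b₀ → 2 < p₀ → ∃ γ₁ : ℝ, 0 < γ₁ ∧
      ∀ (F : T3Family) (γ : ℝ), F.L = L → 0 < γ → γ ≤ γ₁ → UnitTiltAt F γ b₀ p₀ m)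
    (hK2 : ∀ (L m : ℕ), 0 < m → ∃ (b₀ p₀ γ₁ : ℝ), 0 < b₀ ∧ 2 < p₀ ∧ 0 < γ₁ ∧
      ∀ (F : T3Family) (γ : ℝ), F.L = L → 0 < γ → γ ≤ γ₁ → HistoryTailAt F γ b₀ p₀ m)
    (F : T3Family) {γ : ℝ} (hγ : 0 < γ) : ContinuumYM3Torus F ℰp γ := by
  obtain ⟨m, hm, hS⟩ := hK1 F.L
  obtain ⟨b₀, p₀, γ₂, hb₀, hp₀, hγ₂, hT⟩ := hK2 F.L m hm
  obtain ⟨γ₃, hγ₃, hS⟩ := hS b₀ p₀ hb₀ hp₀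
  obtain ⟨n, hpos, hle⟩ := exists_refine_depth F.hL.2 hγ (lt_min hγ₂ hγ₃)
  exact continuumYM3Torus_of_unitTiltAt_historyTailAt F hγ.le n
    (hS (F.refine n) _ rfl hpos (hle.trans (min_le_right _ _)))
    (hT (F.refine n) _ rfl hpos (hle.trans (min_le_left _ _)))

/-- **PACKAGE B′ (the profile chosen by K2 uniformly in `m`, `m` chosen by K1 per profile)**: K1 `∀ L profile, ∃ m > 0, ∃ γ₁ > 0,
…` ∧ K2 `∀ L, ∃ profile, ∀ m > 0, ∃ γ₁ > 0, …` ⇒ the same conclusion. [cite: King1986, (3.12) p.657] -/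
theorem continuumYM3Torus_of_K1_K2'
    (hK1 : ∀ (L : ℕ) (b₀ p₀ : ℝ), 0 < b₀ → 2 < p₀ → ∃ m : ℕ, 0 < m ∧ ∃ γ₁ : ℝ, 0 < γ₁ ∧
      ∀ (F : T3Family) (γ : ℝ), F.L = L → 0 < γ → γ ≤ γ₁ → UnitTiltAt F γ b₀ p₀ m)
    (hK2 : ∀ (L : ℕ), ∃ (b₀ p₀ : ℝ), 0 < b₀ ∧ 2 < p₀ ∧ ∀ m : ℕ, 0 < m → ∃ γ₁ : ℝ, 0 < γ₁ ∧
      ∀ (F : T3Family) (γ : ℝ), F.L = L → 0 < γ → γ ≤ γ₁ → HistoryTailAt F γ b₀ p₀ m)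
    (F : T3Family) {γ : ℝ} (hγ : 0 < γ) : ContinuumYM3Torus F ℰp γ := by
  obtain ⟨b₀, p₀, hb₀, hp₀, hT⟩ := hK2 F.L
  obtain ⟨m, hm, γ₃, hγ₃, hS⟩ := hK1 F.L b₀ p₀ hb₀ hp₀
  obtain ⟨γ₂, hγ₂, hT⟩ := hT m hm
  obtain ⟨n, hpos, hle⟩ := exists_refine_depth F.hL.2 hγ (lt_min hγ₂ hγ₃)
  exact continuumYM3Torus_of_unitTiltAt_historyTailAt F hγ.le n
    (hS (F.refine n) _ rfl hpos (hle.trans (min_le_right _ _)))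
    (hT (F.refine n) _ rfl hpos (hle.trans (min_le_left _ _)))

/-- **THE ROUTE'S TEXT IS AN INSTANCE**: the route's K1 body (HOME/route-R3/Sketch.lean `UnitTilt`, inner statement for one `F`, `γ`,
profile, with its literal `let`s) is `UnitTiltAt F γ b₀ p₀ 4` by `Iff.rfl` up to unfolding — recorded as the statement that the
`m := 4` instance of `UnitTiltAt` is literally the filed shape. [cite: King1986, Thm 3.4 (3.9) p.656] -/
theorem unitTiltAt_four_iff (F : T3Family) (γ b₀ p₀ : ℝ) :
    UnitTiltAt F γ b₀ p₀ 4 ↔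
      (let ℰ : LoopAverage (Matrix.specialUnitaryGroup (Fin 2) ℂ) := ExpMeanLog.expMeanLogSU
      let hE : ℰ.MeasurableE := T4ApexTwoLevel.measurableE_expMeanLogSU
      let θ : ℕ → ℝ := fun i => Real.sqrt (γ * ((F.L : ℝ)⁻¹) ^ i) * B10.pFun b₀ p₀ (Real.sqrt (γ * ((F.L : ℝ)⁻¹) ^ i))
      let Gd : (K n : ℕ) → Set (GaugeField (F.P K) 0 (Matrix.specialUnitaryGroup (Fin 2) ℂ)) := fun K n =>
        {U | ∀ j, j + n ≤ K → PlaqSmall (θ (K - j)) (Averaging.iter (fun i => BlockAveraging.blockAvg (P := F.P K) (j := i) ℰ) j U)}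
      ∃ r : ℕ → ℝ, Summable r ∧ ∀ K : ℕ, 0 ≤ r K ∧
        ∃ (h : GaugeField (F.P 0) 0 (Matrix.specialUnitaryGroup (Fin 2) ℂ) → ℝ) (C : ℝ), Measurable h ∧ 0 ≤ C ∧
          (∀ u, |h u| ≤ r K) ∧
          Measure.map ((F.unitFactorisation ℰ hE γ).A (K + 1))
              ((T4GenFunBounds.gibbsMeasure (F.P (K + 1)) ((F.scheme ℰ γ).β (K + 1))).restrict (Gd (K + 1) (K / 4))) =
            (Measure.map ((F.unitFactorisation ℰ hE γ).A K)
              ((T4GenFunBounds.gibbsMeasure (F.P K) ((F.scheme ℰ γ).β K)).restrict (Gd K (K / 4)))).withDensity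
              fun u => ENNReal.ofReal (C * Real.exp (h u))) :=
  Iff.rfl

end Route

end Literature.MathematicalPhysics.QuantumFieldTheory.Balaban1983to89.T3UnitScaleTilt

end
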